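import Summits.RiemannHypothesis.RiemannHypothesis.Theorems.MotivicDoorDecreeDilation
import HarnessLib

/-!
# The decreed distribution `N` at `u = 1`: the Hadamard kernel form and the second order

Connes–Consani motivic door, cc-3 gen 19 (RH-free: no zeros of `ζ`, no positivity; the
explicit formula only through the exact cutoff identity `ccN_toMul_eq_cutoff`).
Framing: lottery ticket at the motivic door; RH probability negligible; consolation prizes are
real: a new semi-local Weil-positivity theorem, or a located gap in the Connes–Consani programme,
plus the ff-door theorem.  VERDICT (standing): `Nonempty ArithmeticWeilSurface` is a restatement
of RH in structure clothing, not a different-looking hypothesis.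

`MotivicDoorDecreeFinitePart` wrote `N = Σ_n Λ(n) n^{-1/2} δ_{log n} + Pf(w dt) + C₀ δ₀` on the
additive side (`w(t) = e^{t/2}/(2 sinh t)`, `C₀ = ½(γ + log 2π)`, `Pf` with a remainder `r(δ)`);
`MotivicDoorDecreeDilation` paired `N` with dilates `φ_ε = φ(·/ε)` to first order.  Here
`w = 1/(2t) + K`: ALL the singularity sits in Hadamard's `½ Pf(dt/t)`, the rest is the bounded
density `K = w − 1/(2t) = −k_r/2` (`k_r = archResidualKernel`), `K(0⁺) = ¼`, `|K − ¼| ≤ t/8` on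
`(0, 1]`; so `r` is identified (`r(δ) = ∫₀^δ K`) and the dilation law becomes EXACT.
PROVED (`N = ccN` on `toMul`; `κ`, `φ` real Weil tests; `P(φ) = ∫₁^∞ φ ds/(2s)
− ∫₀¹ (φ(0) − φ) ds/(2s) = ½ Pf∫₀^∞ φ ds/s`):
* `ccN_toMul_eq_hadamard` (**Hadamard form**; `κ = 0` on `[2a, ∞)`), `ccN_toMul_eq_hadamard_tsum`:
  `N(toMul κ) = Σ_{log n < 2a} Λ(n) n^{-1/2} κ(log n) + C₀ κ(0) + P(κ) + ∫₀^∞ K κ dt`;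
* `finitePartRem_eq_integral` (`0 < δ ≤ 1`): `r(δ) = ∫₀^δ K dt` — proved by TESTING the
  Hadamard form on a flat-top bump; `abs_finitePartRem_sub_le_sq`: `|r(δ) − δ/4| ≤ δ²/16`;
* `ccN_toMul_dilate_eq_hadamard` (**exact dilation law**; `φ = 0` off `(−ρ, ρ)`, `0 < ε ≤ 1`,
  `ερ ≤ ½`): `N(toMul φ_ε) = (C₀ + ½ log ε) φ(0) + P(φ) + ε ∫₀^∞ K(εs) φ(s) ds`;
  `abs_ccN_toMul_dilate_sub_le_quarter`: the last term is `≤ ε/4 ∫₀^∞ |φ|`;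
* `abs_ccN_toMul_dilate_sub_quarter_le` (**second order**):
  `|N(toMul φ_ε) − [(C₀ + ½ log ε) φ(0) + P(φ) + ε/4 ∫₀^∞ φ]| ≤ ε²/8 ∫₀^∞ s |φ(s)| ds`;
* `tendsto_ccN_toMul_dilate_secondOrder`: for EVERY real Weil test `φ`, as `ε → 0⁺`,
  `(N(toMul φ_ε) − (C₀ + ½ log ε) φ(0) − P(φ))/ε → ¼ ∫₀^∞ φ = K(0⁺) ∫₀^∞ φ`.
PRINTED (Connes, Essay, arXiv:1509.05576, p. 14 l. 45–57, eq. (27)): the archimedean part of `N`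
is the distribution `∫₁^∞ κ(u) f(u) d*u = ∫₁^∞ (u² f(u) − f(1))/(u² − 1) d*u + c f(1)` (principal
value at `u = 1`; Connes–Consani arXiv:1805.10501 §3.1).  READING (ours): in `t = log u`, with
the `u^{-1/2}` of `toMul`, that principal value is `½ Pf(dt/t) + K(t) dt` with `K` bounded and
continuous down to `t = 0⁺` — the form proved here, RH-free.
NOT CLAIMED: anything about the zeros, `ω`, or positivity; nothing in this file bears on RH.
DATA: none (no numerics).
-/
noncomputable section
set_option linter.dupNamespace false

open Complex Set MeasureTheory Filter Topology Literature.NumberTheory.LFunctions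
open Literature.NumberTheory.ConnesConsani2019
open Summit.RiemannHypothesis.RiemannHypothesis.Theorems.MotivicDoor.ArchLogLaplacian
open scoped Real ComplexConjugate ArithmeticFunction.vonMangoldt

namespace Summit.RiemannHypothesis.RiemannHypothesis.Theorems.MotivicDoor.ConnesConsani

variable {κ φ : ℝ → ℝ}

/-! ## 1. The Hadamard kernel `K(t) = w(t) − 1/(2t) = −k_r(t)/2` -/

/-- `w(t) − 1/(2t) = −k_r(t)/2` (`k_r = archResidualKernel`).  PROVED. -/
theorem weilArchDensity_sub_inv_eq_neg_archResidualKernel_div (t : ℝ) :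
    weilArchDensity t - 1 / (2 * t) = -(archResidualKernel t / 2) := by
  have h := two_mul_weilArchDensity_eq t
  rw [show (1 : ℝ) / (2 * t) = 1 / t / 2 by ring]
  linarith

/-- `|K(t) − ¼| ≤ t/8` on `(0, 1]` (from `|k_r + ½| ≤ t/4`): `K(0⁺) = ¼` with a rate.  PROVED. -/
theorem abs_weilArchDensity_sub_inv_sub_quarter_le {t : ℝ} (ht : 0 < t) (ht1 : t ≤ 1) :
    |weilArchDensity t - 1 / (2 * t) - 1 / 4| ≤ t / 8 := by
  have h := abs_archResidualKernel_add_half_le ht ht1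
  rw [weilArchDensity_sub_inv_eq_neg_archResidualKernel_div,
    show -(archResidualKernel t / 2) - 1 / 4 = -((archResidualKernel t + 1 / 2) / 2) by ring,
    abs_neg, abs_div, abs_two]
  linarith

/-- `K(t) → ¼` as `t → 0⁺`.  PROVED. -/
theorem tendsto_weilArchDensity_sub_inv_nhdsGT_zero :
    Tendsto (fun t ↦ weilArchDensity t - 1 / (2 * t)) (𝓝[>] 0) (𝓝 (1 / 4)) := by
  have h := (tendsto_archResidualKernel_nhdsGT_zero.div_const 2).neg
  rw [show -(-(1 / 2 : ℝ) / 2) = 1 / 4 by norm_num] at h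
  exact h.congr fun t ↦ (weilArchDensity_sub_inv_eq_neg_archResidualKernel_div t).symm

/-- `K = w − 1/(2t)` is measurable. -/
private theorem hd_measurable : Measurable fun t ↦ weilArchDensity t - 1 / (2 * t) :=
  measurable_weilArchDensity.sub (measurable_const.div (measurable_const.mul measurable_id))

/-- `K` is integrable on every `(c, d]`, `c ≥ 0` (`|K| ≤ ¼` on `(0, ∞)`). -/
private theorem hd_integrableOn_Ioc {c d : ℝ} (hc : 0 ≤ c) :
    IntegrableOn (fun t ↦ weilArchDensity t - 1 / (2 * t)) (Ioc c d) :=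
  Measure.integrableOn_of_bounded (M := 1 / 4) measure_Ioc_lt_top.ne
    hd_measurable.aestronglyMeasurable (by
      filter_upwards [ae_restrict_mem measurableSet_Ioc] with t ht
      exact (Real.norm_eq_abs _).trans_le (abs_weilArchDensity_sub_inv_le (hc.trans_lt ht.1)))

/-- `K κ` is integrable on `(0, ∞)` for a real Weil test `κ`.  PROVED. -/
theorem integrableOn_weilArchDensity_sub_inv_mul_Ioi (hκ : IsWeilTest fun t ↦ (κ t : ℂ)) :
    IntegrableOn (fun t ↦ (weilArchDensity t - 1 / (2 * t)) * κ t) (Ioi 0) :=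
  Integrable.bdd_mul (c := 1 / 4) (integrable_of_isWeilTest hκ).integrableOn
    hd_measurable.aestronglyMeasurable (by
      filter_upwards [ae_restrict_mem measurableSet_Ioi] with t ht
      exact (Real.norm_eq_abs _).trans_le (abs_weilArchDensity_sub_inv_le ht))

/-- `K(εs) φ(s)` is integrable on `(0, ∞)` for a real Weil test `φ` and `ε > 0`. -/
private theorem hd_integrableOn_dilate_mul (hφ : IsWeilTest fun t ↦ (φ t : ℂ)) {ε : ℝ}
    (hε : 0 < ε) :
    IntegrableOn (fun s ↦ (weilArchDensity (ε * s) - 1 / (2 * (ε * s))) * φ s) (Ioi 0) :=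
  Integrable.bdd_mul (c := 1 / 4) (integrable_of_isWeilTest hφ).integrableOn
    (hd_measurable.comp (measurable_const.mul measurable_id)).aestronglyMeasurable (by
      filter_upwards [ae_restrict_mem measurableSet_Ioi] with s hs
      exact (Real.norm_eq_abs _).trans_le (abs_weilArchDensity_sub_inv_le (mul_pos hε hs)))

/-! ## 2. The Hadamard form of `N`; identification of the finite-part remainder -/

/-- For `0 < δ ≤ 1`: `N(toMul κ) − [Hadamard form] = (r(δ) − ∫₀^δ K) κ(0)`.  PROVED. -/
private theorem hd_ccN_toMul_sub_hadamard_eq (hκ : IsWeilTest fun t ↦ (κ t : ℂ)) {a : ℝ}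
    (hκa : ∀ t, 2 * a ≤ t → κ t = 0) {δ : ℝ} (hδ : 0 < δ) (hδ1 : δ ≤ 1) :
    ccN (toMul κ) -
        ((∑ n ∈ weilPrimeIndex a, (Λ n : ℝ) / Real.sqrt n * κ (Real.log n)) +
          (Real.eulerMascheroniConstant + Real.log (2 * π)) / 2 * κ 0 +
          ((∫ t in Ioi 1, κ t / (2 * t)) - ∫ t in Ioc 0 1, (κ 0 - κ t) / (2 * t)) +
          ∫ t in Ioi 0, (weilArchDensity t - 1 / (2 * t)) * κ t) =
      ((∫ t in Ioc 0 δ, (Real.exp (t / 2) - 1) / (2 * Real.sinh t)) +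
          1 / 2 * (Real.log (Real.sinh (δ / 2)) - Real.log (Real.cosh (δ / 2)) -
            Real.log (δ / 2)) -
          ∫ t in Ioc 0 δ, (weilArchDensity t - 1 / (2 * t))) * κ 0 := by
  have hK := integrableOn_weilArchDensity_sub_inv_mul_Ioi hκ
  have hKδ := hK.mono_set (Ioi_subset_Ioi hδ.le)
  have hK0 : IntegrableOn (fun t ↦ (weilArchDensity t - 1 / (2 * t)) * κ t) (Ioc 0 δ) :=
    hK.mono_set Ioc_subset_Ioi_self
  have hI1 := integrableOn_div_two_mul_Ioi hκ
  have hI0 := integrableOn_sub_div_two_mul_Ioc hκ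
  have hI0δ := hI0.mono_set (Ioc_subset_Ioc_right hδ1)
  have hI01 := hI0.mono_set (Ioc_subset_Ioc_left hδ.le)
  have hKc := hd_integrableOn_Ioc (d := δ) le_rfl
  have hD : IntegrableOn (fun t ↦ κ t / (2 * t)) (Ioi δ) :=
    IntegrableOn.congr_fun (Integrable.sub' (integrableOn_weilArchDensity_mul_Ioi hκ hδ) hKδ)
      (fun t _ ↦ by ring) measurableSet_Ioi
  have hc : IntegrableOn (fun t : ℝ ↦ 1 / (2 * t)) (Ioc δ 1) := by
    refine (ContinuousOn.div continuousOn_const (by fun_prop) fun t ht ↦ ?_).integrableOn_Icc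
      |>.mono_set Ioc_subset_Icc_self
    exact (mul_pos two_pos (hδ.trans_le ht.1)).ne'
  have hlog : ∫ t in Ioc δ 1, 1 / (2 * t) = -(Real.log δ / 2) := by
    simp_rw [← intervalIntegral.integral_of_le hδ1, show ∀ t : ℝ, 1 / (2 * t) = 2⁻¹ * t⁻¹ from
      fun t ↦ by rw [one_div, mul_inv], intervalIntegral.integral_const_mul,
      integral_inv_of_pos hδ one_pos, one_div, Real.log_inv]
    ring
  have e1 : ∫ t in Ioi δ, weilArchDensity t * κ t =
      (∫ t in Ioi δ, κ t / (2 * t)) + ∫ t in Ioi δ, (weilArchDensity t - 1 / (2 * t)) * κ t := by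
    rw [← integral_add hD hKδ]
    exact setIntegral_congr_fun measurableSet_Ioi fun t _ ↦ by ring
  have e2 : ∫ t in Ioi δ, κ t / (2 * t) =
      (∫ t in Ioc δ 1, κ t / (2 * t)) + ∫ t in Ioi 1, κ t / (2 * t) := by
    rw [← Ioc_union_Ioi_eq_Ioi hδ1, setIntegral_union (Set.Ioc_disjoint_Ioi le_rfl)
      measurableSet_Ioi (hD.mono_set Ioc_subset_Ioi_self) hI1]
  have e3 : ∫ t in Ioc δ 1, κ t / (2 * t) =
      -(Real.log δ / 2) * κ 0 - ∫ t in Ioc δ 1, (κ 0 - κ t) / (2 * t) := by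
    rw [← hlog, ← integral_mul_const, ← integral_sub (hc.mul_const _) hI01]
    exact setIntegral_congr_fun measurableSet_Ioc fun t _ ↦ by ring
  have e4 : ∫ t in Ioc 0 δ, weilArchDensity t * (κ 0 - κ t) =
      (∫ t in Ioc 0 δ, (κ 0 - κ t) / (2 * t)) +
        (∫ t in Ioc 0 δ, (weilArchDensity t - 1 / (2 * t))) * κ 0 -
        ∫ t in Ioc 0 δ, (weilArchDensity t - 1 / (2 * t)) * κ t := by
    rw [← integral_mul_const, ← integral_add hI0δ (hKc.mul_const _), ← integral_sub _ hK0]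
    · exact setIntegral_congr_fun measurableSet_Ioc fun t _ ↦ by ring
    · exact hI0δ.add (hKc.mul_const _)
  have e5 : ∫ t in Ioc 0 1, (κ 0 - κ t) / (2 * t) =
      (∫ t in Ioc 0 δ, (κ 0 - κ t) / (2 * t)) + ∫ t in Ioc δ 1, (κ 0 - κ t) / (2 * t) := by
    rw [← Ioc_union_Ioc_eq_Ioc hδ.le hδ1, setIntegral_union (Ioc_disjoint_Ioc_of_le le_rfl)
      measurableSet_Ioc hI0δ hI01]
  have e6 : ∫ t in Ioi 0, (weilArchDensity t - 1 / (2 * t)) * κ t =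
      (∫ t in Ioc 0 δ, (weilArchDensity t - 1 / (2 * t)) * κ t) +
        ∫ t in Ioi δ, (weilArchDensity t - 1 / (2 * t)) * κ t := by
    rw [← Ioc_union_Ioi_eq_Ioi hδ.le, setIntegral_union (Set.Ioc_disjoint_Ioi le_rfl)
      measurableSet_Ioi hK0 hKδ]
  rw [ccN_toMul_eq_cutoff hκ hκa hδ, finitePartCoeff_eq a hδ, e1, e2, e3, e4, e5, e6]
  ring

/-- **Hadamard form of the decree `N` on the additive side.**  For a real Weil test `κ`
vanishing on `[2a, ∞)`:
`N(toMul κ) = Σ_{log n < 2a} Λ(n) n^{-1/2} κ(log n) + ½(γ + log 2π) κ(0)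
  + [∫₁^∞ κ dt/(2t) − ∫₀¹ (κ(0) − κ) dt/(2t)] + ∫₀^∞ K(t) κ(t) dt`,
`K = w − 1/(2t)` bounded (`|K| ≤ ¼`, `K(0⁺) = ¼`): the singular part of `Pf(w dt)` is exactly
Hadamard's `½ Pf(dt/t)`, the rest an honest density.  PROVED (RH-free). -/
theorem ccN_toMul_eq_hadamard (hκ : IsWeilTest fun t ↦ (κ t : ℂ)) {a : ℝ}
    (hκa : ∀ t, 2 * a ≤ t → κ t = 0) :
    ccN (toMul κ) =
      (∑ n ∈ weilPrimeIndex a, (Λ n : ℝ) / Real.sqrt n * κ (Real.log n)) +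
        (Real.eulerMascheroniConstant + Real.log (2 * π)) / 2 * κ 0 +
        ((∫ t in Ioi 1, κ t / (2 * t)) - ∫ t in Ioc 0 1, (κ 0 - κ t) / (2 * t)) +
        ∫ t in Ioi 0, (weilArchDensity t - 1 / (2 * t)) * κ t := by
  have hT : Tendsto (fun δ : ℝ ↦ δ * |κ 0|) (𝓝[>] 0) (𝓝 0) := by
    simpa only [zero_mul, id_eq] using ((tendsto_id : Tendsto (id : ℝ → ℝ) (𝓝 0)
      (𝓝 0)).mono_left nhdsWithin_le_nhds).mul_const |κ 0|
  refine sub_eq_zero.1 (abs_nonpos_iff.1 (ge_of_tendsto hT ?_))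
  filter_upwards [Ioc_mem_nhdsGT one_pos] with δ hδ
  rw [hd_ccN_toMul_sub_hadamard_eq hκ hκa hδ.1 hδ.2, abs_mul]
  refine mul_le_mul_of_nonneg_right ?_ (abs_nonneg _)
  have hi : ‖∫ t in Ioc 0 δ, (weilArchDensity t - 1 / (2 * t))‖ ≤
      1 / 4 * volume.real (Ioc 0 δ) :=
    norm_setIntegral_le_of_norm_le_const measure_Ioc_lt_top fun t ht ↦
      (Real.norm_eq_abs _).trans_le (abs_weilArchDensity_sub_inv_le ht.1)
  rw [Real.volume_real_Ioc_of_le hδ.1.le, sub_zero, Real.norm_eq_abs] at hi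
  calc _ ≤ _ := abs_sub _ _
    _ ≤ 3 / 4 * δ + 1 / 4 * δ := add_le_add (abs_finitePartRem_le hδ.1 (by linarith [hδ.2])) hi
    _ = δ := by ring

/-- The Hadamard form with the full prime sum `Σ_n Λ(n) (toMul κ)(n)` (no window).  PROVED. -/
theorem ccN_toMul_eq_hadamard_tsum (hκ : IsWeilTest fun t ↦ (κ t : ℂ)) :
    ccN (toMul κ) =
      (∑' n : ℕ, Λ n * toMul κ n) +
        (Real.eulerMascheroniConstant + Real.log (2 * π)) / 2 * κ 0 +
        ((∫ t in Ioi 1, κ t / (2 * t)) - ∫ t in Ioc 0 1, (κ 0 - κ t) / (2 * t)) +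
        ∫ t in Ioi 0, (weilArchDensity t - 1 / (2 * t)) * κ t := by
  obtain ⟨R, hR0, hR⟩ := exists_eq_zero_of_lt_abs_of_isWeilTest hκ
  have hκa : ∀ t, 2 * ((R + 1) / 2) ≤ t → κ t = 0 := fun t ht ↦
    hR t (by rw [abs_of_nonneg (by linarith)]; linarith)
  rw [tsum_vonMangoldt_mul_toMul_eq_sum κ hκa]
  exact ccN_toMul_eq_hadamard hκ hκa

/-- **The finite-part remainder is the primitive of `K`.**  For `0 < δ ≤ 1`,
`r(δ) = ∫₀^δ (w(t) − 1/(2t)) dt`, `r` the remainder of `finitePartCoeff_eq`.  PROVED — by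
testing the Hadamard form on a flat-top bump with `κ(0) = 1` (no special-function calculus). -/
theorem finitePartRem_eq_integral {δ : ℝ} (hδ : 0 < δ) (hδ1 : δ ≤ 1) :
    (∫ t in Ioc 0 δ, (Real.exp (t / 2) - 1) / (2 * Real.sinh t)) +
        1 / 2 * (Real.log (Real.sinh (δ / 2)) - Real.log (Real.cosh (δ / 2)) -
          Real.log (δ / 2)) =
      ∫ t in Ioc 0 δ, (weilArchDensity t - 1 / (2 * t)) := by
  obtain ⟨κ, hκ, -, hκ0, hκs, -⟩ := exists_weilTest_flatTop one_pos
  have hκa : ∀ t, 2 * (1 / 2 : ℝ) ≤ t → κ t = 0 := fun t ht ↦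
    hκs t (by linarith [le_abs_self t])
  have h := hd_ccN_toMul_sub_hadamard_eq hκ hκa hδ hδ1
  rw [ccN_toMul_eq_hadamard hκ hκa, sub_self, hκ0, mul_one] at h
  exact sub_eq_zero.1 h.symm

/-- `|r(δ) − δ/4| ≤ δ²/16` for `0 < δ ≤ 1`: the finite-part remainder has slope `K(0⁺) = ¼`
at `0⁺`.  PROVED (from `|K − ¼| ≤ t/8`). -/
theorem abs_finitePartRem_sub_le_sq {δ : ℝ} (hδ : 0 < δ) (hδ1 : δ ≤ 1) :
    |(∫ t in Ioc 0 δ, (Real.exp (t / 2) - 1) / (2 * Real.sinh t)) +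
        1 / 2 * (Real.log (Real.sinh (δ / 2)) - Real.log (Real.cosh (δ / 2)) -
          Real.log (δ / 2)) - δ / 4| ≤ δ ^ 2 / 16 := by
  have hq : ∫ _ in Ioc 0 δ, (1 / 4 : ℝ) = δ / 4 := by
    rw [setIntegral_const, Real.volume_real_Ioc_of_le hδ.le, smul_eq_mul]
    ring
  have h8 : ∫ t in Ioc 0 δ, t / 8 = δ ^ 2 / 16 := by
    rw [← intervalIntegral.integral_of_le hδ.le, intervalIntegral.integral_div, integral_id]
    ring
  rw [finitePartRem_eq_integral hδ hδ1, ← hq,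
    ← integral_sub (hd_integrableOn_Ioc le_rfl) continuous_const.integrableOn_Ioc, ← h8]
  refine (Real.norm_eq_abs _).symm.trans_le (norm_integral_le_of_norm_le
    (continuous_id.div_const (8 : ℝ)).integrableOn_Ioc ?_)
  filter_upwards [ae_restrict_mem measurableSet_Ioc] with t ht
  exact (Real.norm_eq_abs _).trans_le
    (abs_weilArchDensity_sub_inv_sub_quarter_le ht.1 (ht.2.trans hδ1))

/-! ## 3. The exact dilation law and its second order -/

/-- **Exact dilation law in Hadamard form.**  For a real Weil test `φ` vanishing off `(−ρ, ρ)`,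
`0 < ε ≤ 1`, `ε ρ ≤ ½`:
`N(toMul φ(·/ε)) = (½(γ + log 2π) + ½ log ε) φ(0) + [∫₁^∞ φ ds/(2s) − ∫₀¹ (φ(0) − φ) ds/(2s)]
  + ε ∫₀^∞ K(εs) φ(s) ds` — the `O(ε)` of `abs_ccN_toMul_dilate_sub_le` in closed form.
PROVED. -/
theorem ccN_toMul_dilate_eq_hadamard (hφ : IsWeilTest fun t ↦ (φ t : ℂ)) {ρ : ℝ}
    (hρ : ∀ t, ρ ≤ |t| → φ t = 0) {ε : ℝ} (hε : 0 < ε) (hε1 : ε ≤ 1) (hερ : ε * ρ ≤ 1 / 2) :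
    ccN (toMul fun t ↦ φ (t / ε)) =
      ((Real.eulerMascheroniConstant + Real.log (2 * π)) / 2 + Real.log ε / 2) * φ 0 +
          ((∫ s in Ioi 1, φ s / (2 * s)) - ∫ s in Ioc 0 1, (φ 0 - φ s) / (2 * s)) +
        ε * ∫ s in Ioi 0, (weilArchDensity (ε * s) - 1 / (2 * (ε * s))) * φ s := by
  have hε0 := hε.ne'
  have hI1 := integrableOn_div_two_mul_Ioi hφ
  have hI0 := integrableOn_sub_div_two_mul_Ioc hφ
  have hKφ := hd_integrableOn_dilate_mul hφ hε
  have hKφ1 := hKφ.mono_set (Ioi_subset_Ioi zero_le_one)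
  have hKφ0 : IntegrableOn (fun s ↦ (weilArchDensity (ε * s) - 1 / (2 * (ε * s))) * φ s)
      (Ioc 0 1) := hKφ.mono_set Ioc_subset_Ioi_self
  have hKε : IntegrableOn (fun s ↦ weilArchDensity (ε * s) - 1 / (2 * (ε * s))) (Ioc 0 1) :=
    Measure.integrableOn_of_bounded (M := 1 / 4) measure_Ioc_lt_top.ne
      (hd_measurable.comp (measurable_const.mul measurable_id)).aestronglyMeasurable (by
        filter_upwards [ae_restrict_mem measurableSet_Ioc] with s hs
        exact (Real.norm_eq_abs _).trans_le (abs_weilArchDensity_sub_inv_le (mul_pos hε hs.1)))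
  have hk : ∀ s : ℝ, ε * (1 / (2 * (ε * s))) = 1 / (2 * s) := fun s ↦ by
    rw [mul_one_div, mul_left_comm, div_mul_cancel_left₀ hε0, one_div]
  have hr : (∫ t in Ioc 0 ε, (Real.exp (t / 2) - 1) / (2 * Real.sinh t)) +
      1 / 2 * (Real.log (Real.sinh (ε / 2)) - Real.log (Real.cosh (ε / 2)) - Real.log (ε / 2)) =
      ε * ∫ s in Ioc 0 1, (weilArchDensity (ε * s) - 1 / (2 * (ε * s))) := by
    have h := intervalIntegral.integral_comp_mul_left (a := 0) (b := 1)
      (fun t ↦ weilArchDensity t - 1 / (2 * t)) hε0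
    simp only [mul_zero, mul_one, smul_eq_mul] at h
    rw [finitePartRem_eq_integral hε hε1, ← intervalIntegral.integral_of_le hε.le,
      ← intervalIntegral.integral_of_le zero_le_one, h, mul_inv_cancel_left₀ hε0]
  have eA : ε * (∫ s in Ioi 1, weilArchDensity (ε * s) * φ s) = (∫ s in Ioi 1, φ s / (2 * s)) +
      ε * ∫ s in Ioi 1, (weilArchDensity (ε * s) - 1 / (2 * (ε * s))) * φ s := by
    rw [← integral_const_mul, ← integral_const_mul, ← integral_add hI1 (hKφ1.const_mul ε)]
    refine setIntegral_congr_fun measurableSet_Ioi fun s _ ↦ ?_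
    linear_combination φ s * hk s
  have eB : ε * (∫ s in Ioc 0 1, weilArchDensity (ε * s) * (φ 0 - φ s)) =
      (∫ s in Ioc 0 1, (φ 0 - φ s) / (2 * s)) +
        (ε * ∫ s in Ioc 0 1, (weilArchDensity (ε * s) - 1 / (2 * (ε * s)))) * φ 0 -
        ε * ∫ s in Ioc 0 1, (weilArchDensity (ε * s) - 1 / (2 * (ε * s))) * φ s := by
    rw [← integral_const_mul, ← integral_const_mul, ← integral_const_mul, ← integral_mul_const,
      ← integral_add hI0 ((hKε.const_mul ε).mul_const _), ← integral_sub _ (hKφ0.const_mul ε)]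
    · refine setIntegral_congr_fun measurableSet_Ioc fun s _ ↦ ?_
      linear_combination (φ 0 - φ s) * hk s
    · exact hI0.add ((hKε.const_mul ε).mul_const _)
  have eS : ∫ s in Ioi 0, (weilArchDensity (ε * s) - 1 / (2 * (ε * s))) * φ s =
      (∫ s in Ioc 0 1, (weilArchDensity (ε * s) - 1 / (2 * (ε * s))) * φ s) +
        ∫ s in Ioi 1, (weilArchDensity (ε * s) - 1 / (2 * (ε * s))) * φ s := by
    rw [← Ioc_union_Ioi_eq_Ioi zero_le_one, setIntegral_union (Set.Ioc_disjoint_Ioi le_rfl)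
      measurableSet_Ioi hKφ0 hKφ1]
  rw [ccN_toMul_dilate_eq hφ hρ hε hερ, hr, eA, eB, eS]
  ring

/-- **Dilation law, sharp first-order constant**: under the same hypotheses,
`|N(toMul φ(·/ε)) − [(½(γ + log 2π) + ½ log ε) φ(0) + ∫₁^∞ φ ds/(2s) − ∫₀¹ (φ(0) − φ) ds/(2s)]|
≤ ε/4 ∫₀^∞ |φ|`.  PROVED (`|K| ≤ ¼`). -/
theorem abs_ccN_toMul_dilate_sub_le_quarter (hφ : IsWeilTest fun t ↦ (φ t : ℂ)) {ρ : ℝ}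
    (hρ : ∀ t, ρ ≤ |t| → φ t = 0) {ε : ℝ} (hε : 0 < ε) (hε1 : ε ≤ 1) (hερ : ε * ρ ≤ 1 / 2) :
    |ccN (toMul fun t ↦ φ (t / ε)) -
        (((Real.eulerMascheroniConstant + Real.log (2 * π)) / 2 + Real.log ε / 2) * φ 0 +
          ((∫ s in Ioi 1, φ s / (2 * s)) - ∫ s in Ioc 0 1, (φ 0 - φ s) / (2 * s)))| ≤
      ε / 4 * ∫ s in Ioi 0, |φ s| := by
  have hφi := (integrable_of_isWeilTest hφ).integrableOn (s := Ioi 0)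
  rw [ccN_toMul_dilate_eq_hadamard hφ hρ hε hε1 hερ, add_sub_cancel_left, abs_mul,
    abs_of_pos hε, show ε / 4 * ∫ s in Ioi 0, |φ s| = ε * ∫ s in Ioi 0, 1 / 4 * |φ s| by
      rw [integral_const_mul]; ring]
  refine mul_le_mul_of_nonneg_left ((Real.norm_eq_abs _).symm.trans_le
    (norm_integral_le_of_norm_le (hφi.abs.const_mul _) ?_)) hε.le
  filter_upwards [ae_restrict_mem measurableSet_Ioi] with s hs
  rw [Real.norm_eq_abs, abs_mul]
  exact mul_le_mul_of_nonneg_right (abs_weilArchDensity_sub_inv_le (mul_pos hε hs))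
    (abs_nonneg _)

/-- **Second-order dilation law.**  For a real Weil test `φ` vanishing off `(−ρ, ρ)`,
`0 < ε ≤ 1`, `ε ρ ≤ ½`:  `|N(toMul φ(·/ε)) − [(½(γ + log 2π) + ½ log ε) φ(0)
  + ∫₁^∞ φ ds/(2s) − ∫₀¹ (φ(0) − φ) ds/(2s) + ε/4 ∫₀^∞ φ]| ≤ ε²/8 ∫₀^∞ s |φ(s)| ds`.
PROVED (`|K(εs) − ¼| ≤ εs/8` on the support of `φ`). -/
theorem abs_ccN_toMul_dilate_sub_quarter_le (hφ : IsWeilTest fun t ↦ (φ t : ℂ)) {ρ : ℝ}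
    (hρ : ∀ t, ρ ≤ |t| → φ t = 0) {ε : ℝ} (hε : 0 < ε) (hε1 : ε ≤ 1) (hερ : ε * ρ ≤ 1 / 2) :
    |ccN (toMul fun t ↦ φ (t / ε)) -
        (((Real.eulerMascheroniConstant + Real.log (2 * π)) / 2 + Real.log ε / 2) * φ 0 +
            ((∫ s in Ioi 1, φ s / (2 * s)) - ∫ s in Ioc 0 1, (φ 0 - φ s) / (2 * s)) +
          ε / 4 * ∫ s in Ioi 0, φ s)| ≤
      ε ^ 2 / 8 * ∫ s in Ioi 0, s * |φ s| := by
  have hKφ := hd_integrableOn_dilate_mul hφ hε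
  have hm : Integrable fun s ↦ s * |φ s| := by
    refine (continuous_id.mul (AWS.contDiff_of_isWeilTest hφ).continuous.abs)
      |>.integrable_of_hasCompactSupport (HasCompactSupport.intro (K := Icc (-ρ) ρ)
        isCompact_Icc fun s hs ↦ ?_)
    have h : ρ ≤ |s| := by
      rw [mem_Icc, not_and_or, not_le, not_le] at hs
      rcases hs with h | h <;> linarith [neg_le_abs s, le_abs_self s]
    simp [hρ s h]
  rw [ccN_toMul_dilate_eq_hadamard hφ hρ hε hε1 hερ, add_sub_add_left_eq_sub,
    show ε / 4 * ∫ s in Ioi 0, φ s = ε * ∫ s in Ioi 0, 1 / 4 * φ s by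
      rw [integral_const_mul]; ring,
    ← mul_sub, ← integral_sub hKφ ((integrable_of_isWeilTest hφ).integrableOn.const_mul _),
    abs_mul, abs_of_pos hε, show ε ^ 2 / 8 * ∫ s in Ioi 0, s * |φ s| =
      ε * ∫ s in Ioi 0, ε / 8 * (s * |φ s|) by rw [integral_const_mul]; ring]
  refine mul_le_mul_of_nonneg_left ((Real.norm_eq_abs _).symm.trans_le
    (norm_integral_le_of_norm_le (hm.integrableOn.const_mul _) ?_)) hε.le
  filter_upwards [ae_restrict_mem measurableSet_Ioi] with s hs
  rw [Real.norm_eq_abs, ← sub_mul, abs_mul,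
    show ε / 8 * (s * |φ s|) = ε * s / 8 * |φ s| by ring]
  by_cases h0 : φ s = 0
  · simp [h0]
  refine mul_le_mul_of_nonneg_right ?_ (abs_nonneg _)
  have hsρ : s < ρ := by
    simpa only [abs_of_pos (mem_Ioi.1 hs)] using lt_of_not_ge (mt (hρ s) h0)
  exact abs_weilArchDensity_sub_inv_sub_quarter_le (mul_pos hε hs)
    ((mul_le_mul_of_nonneg_left hsρ.le hε.le).trans (hερ.trans (by norm_num)))

/-- **Second-order dilation law, limit form**: for EVERY real Weil test `φ`, as `ε → 0⁺`,
`(N(toMul φ(·/ε)) − (½(γ + log 2π) + ½ log ε) φ(0) − [∫₁^∞ φ ds/(2s) − ∫₀¹ (φ(0) − φ) ds/(2s)])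
/ ε → ¼ ∫₀^∞ φ(s) ds = K(0⁺) ∫₀^∞ φ`.  PROVED. -/
theorem tendsto_ccN_toMul_dilate_secondOrder (hφ : IsWeilTest fun t ↦ (φ t : ℂ)) :
    Tendsto (fun ε ↦ (ccN (toMul fun t ↦ φ (t / ε)) -
        (((Real.eulerMascheroniConstant + Real.log (2 * π)) / 2 + Real.log ε / 2) * φ 0 +
          ((∫ s in Ioi 1, φ s / (2 * s)) - ∫ s in Ioc 0 1, (φ 0 - φ s) / (2 * s)))) / ε)
      (𝓝[>] 0) (𝓝 (1 / 4 * ∫ s in Ioi 0, φ s)) := by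
  obtain ⟨R, hR0, hR⟩ := exists_eq_zero_of_lt_abs_of_isWeilTest hφ
  have hρ : ∀ t, R + 1 ≤ |t| → φ t = 0 := fun t ht ↦ hR t (by linarith)
  have hb : Tendsto (fun ε : ℝ ↦ ε * (1 / 8 * ∫ s in Ioi 0, s * |φ s|)) (𝓝[>] 0) (𝓝 0) := by
    simpa only [zero_mul, id_eq] using ((tendsto_id : Tendsto (id : ℝ → ℝ) (𝓝 0)
      (𝓝 0)).mono_left nhdsWithin_le_nhds).mul_const (1 / 8 * ∫ s in Ioi 0, s * |φ s|)
  rw [← tendsto_sub_nhds_zero_iff]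
  refine squeeze_zero_norm' ?_ hb
  have hm : (0 : ℝ) < min 1 (1 / (2 * (R + 1))) := lt_min one_pos (by positivity)
  filter_upwards [Ioc_mem_nhdsGT hm] with ε hε
  have hε0 : ε ≠ 0 := hε.1.ne'
  have hε1 : ε ≤ 1 := hε.2.trans (min_le_left _ _)
  have hερ : ε * (R + 1) ≤ 1 / 2 := by
    have h := hε.2.trans (min_le_right _ _); rw [le_div_iff₀ (by positivity)] at h; linarith
  have h := abs_ccN_toMul_dilate_sub_quarter_le hφ hρ hε.1 hε1 hερ
  have e : ∀ N F I : ℝ, (N - F) / ε - 1 / 4 * I = (N - (F + ε / 4 * I)) / ε := fun N F I ↦ by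
    rw [eq_div_iff hε0, sub_mul, div_mul_cancel₀ _ hε0]
    ring
  rw [Real.norm_eq_abs, e, abs_div, abs_of_pos hε.1, div_le_iff₀ hε.1]
  calc _ ≤ _ := h
    _ = ε * (1 / 8 * ∫ s in Ioi 0, s * |φ s|) * ε := by ring

end Summit.RiemannHypothesis.RiemannHypothesis.Theorems.MotivicDoor.ConnesConsani

end
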